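import Literature.Analysis.FluidPDE.HardSphereShortTime
import Literature.Analysis.FluidPDE.HardSphereFlowMeasurable
import Literature.Analysis.FluidPDE.HardSpherePhaseSpaceProofs
import HarnessLib

/-!
# Liouville's theorem over a short time window: the one-collision map preserves volume

Seventh layer of the proof of Alexander's theorem on `T^d`
(`Kinetic.HardSphereFlow.nonempty_torus`): the measure-theoretic half of the short-time
analysis of `HardSphereShortTime`. On the short-time good set `shortGood ε r δ` the flow at
time `δ` is `S_δ ∘ kick`, where `kick` is the identity or the two-body collision map
`pairCollide ε i j` of one pair; we prove that this map **does not lose volume**: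

* `volume_shortGood_inter_preimage_fwdFlow_le` — for every measurable `B`,
  `vol {z ∈ shortGood ∩ {E ≤ V²/2} | Φ_δ z ∈ B} ≤ vol B`
  (GST 2013, proof of Prop. 4.1.1: "since the measure is invariant by the flow"; CIP 1994
  App. 4.A: the special-flow map is measure preserving "by the Liouville theorem").

The proof transports `HardSphereBilliard`'s change-of-variables theorem
(`addHaar_image_billiardMap`: the billiard map `(q, w) ↦ (q', w')` of the relative motion
preserves Lebesgue measure on `ℝ^d × ℝ^d`) to `N` particles on the torus, by elementary
measure theory only:

* **shears along one coordinate** of `(T^d × ℝ^d)^N` — `shearAt i φ : z ↦ update z i (z i + φ z)`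
  with `φ` not depending on coordinate `i` — preserve volume (Fubini over coordinate `i`,
  `MeasureTheory.lmarginal`, and invariance of Haar × Lebesgue measure under translations,
  `lintegral_add_right_eq_self`) and are bijections (`volume_image_shearAt`); passing to the
  coordinates of particle `i` relative to particle `j` and translating particle `j` by the
  exchanged impulse are such shears;
* **a map acting on one coordinate only**, `applyAt i b : z ↦ update z i (b (z i))`, satisfies
  the image rule `vol(applyAt i b '' S) = vol S` as soon as `b` does on the relevant sections
  (Fubini over coordinate `i` again; measurability of the image by Lusin–Souslin,
  `MeasurableSet.image_of_measurable_injOn`), `volume_image_applyAt`;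
* the **one-particle billiard** `phaseBilliard ε = projPhase ∘ billiardMap ε ∘ liftPhase` on
  `T^d × ℝ^d` (lift the position to the cube `(-1/2, 1/2]^d` by `reprSym`, apply the billiard
  map, project back) satisfies the image rule on data whose image stays in the chart
  (`volume_image_phaseBilliard`, from `addHaar_image_billiardMap` and
  `Torus.map_reprSym_volume`);
* `pairCollide ε i j = Ξ⁻¹ ∘ applyAt i (phaseBilliard ε) ∘ shearAt j ψ ∘ Ξ`
  (`shearAt_pairCollide`), whence `vol(pairCollide ε i j '' A) = vol A` for measurable
  `A` in a hit piece of an energy shell (`volume_image_pairCollide`);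
* free flight is a volume-preserving bijection (`volume_image_freeFlight`, from
  `Kinetic.measurePreserving_freeFlight_of_translate` of `HardSpherePhaseSpaceProofs`), the
  pieces of `shortGood` are measurable, and `kick` is injective on `shortGood`
  (`HardSphereShortTime.kick_injOn`), which assemble into the displayed inequality.

## Mathlib / Literature reuse

`MeasureTheory.lmarginal`, `lmarginal_singleton`, `lintegral_eq_of_lmarginal_eq`,
`lintegral_add_right_eq_self`, `MeasurableSet.image_of_measurable_injOn` (Lusin–Souslin),
`StandardBorelSpace.pi_countable`, `Measure.map_apply`, `Set.image_eq_preimage_of_inverse`,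
`measure_iUnion`, `measure_iUnion_fintype_le`, `MeasurableSet.const`/`MeasurableSet.imp` are Mathlib's. The billiard change of variables
and the measurability of billiard images are `HardSphereBilliard`'s; the `reprSym`/`proj` chart
identities are `HardSphereTorusMeasure`'s; measurability of the flow is
`HardSphereFlowMeasurable`'s. Mathlib has no billiard flow and no "skew product along one
coordinate of a finite product" lemma in image form.

## Design choices

* All statements are *image rules* `vol(f '' S) = vol S` for measurable `S` inside an explicit
  domain, the form in which the change-of-variables theorem is available and which composes.
* `StandardBorelSpace ((T^d × ℝ^d)^N)` is supplied by hand (`standardBorelSpace_config`):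
  instance search does not find it through the `abbrev Config`.

## References

* I. Gallagher, L. Saint-Raymond, B. Texier, *From Newton to Boltzmann: hard spheres and
  short-range potentials*, EMS (2013), arXiv:1208.5753, §4.1, proof of Prop. 4.1.1 (p. 19).
* C. Cercignani, R. Illner, M. Pulvirenti, *The Mathematical Theory of Dilute Gases*, Springer
  (1994), §4.2 p. 65 (the collision transformation preserves Lebesgue measure), App. 4.A
  pp. 107–111.
-/

open Set Filter Topology Function MeasureTheory Metric
open scoped ENNReal InnerProductSpace

namespace Literature.Analysis.FluidPDE

noncomputable section

section Kinetic

namespace Alexander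

variable {d : Type*} [Fintype d] {N : ℕ}

/-! ## The phase space is standard Borel; free flight is a volume-preserving bijection -/

/-- The `N`-particle torus phase space `(T^d × ℝ^d)^N` is a standard Borel space (a finite
product of Polish spaces with their Borel σ-algebras). [folklore] -/
theorem standardBorelSpace_config : StandardBorelSpace (Config N d (UnitAddTorus d)) :=
  haveI : StandardBorelSpace (UnitAddTorus d × EuclideanSpace ℝ d) := standardBorel_of_polish
  StandardBorelSpace.pi_countable

/-- Haar × Lebesgue measure on the one-particle phase space `T^d × ℝ^d` is invariant under
right translations. [folklore] -/
theorem isAddRightInvariant_volume_phase :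
    (volume : Measure (UnitAddTorus d × EuclideanSpace ℝ d)).IsAddRightInvariant := by
  rw [Measure.volume_eq_prod]
  exact Measure.prod.instIsAddRightInvariant

/-- Free flight on `(T^d × ℝ^d)^N` preserves volume, for each time (the case
`G = Torus.geometry d` of `Kinetic.measurePreserving_freeFlight_of_translate`: translations
preserve Haar measure; this is the pointwise content of the named fact
`Kinetic.measurePreserving_freeFlight_torus`, discharged in
`Literature.Barriers.AtomisticToContinuum.BoltzmannHypothesis`). [cite: CIP1994, §4.2] -/
theorem measurePreserving_freeFlight_torusGeometry (t : ℝ) :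
    MeasurePreserving (freeFlight (N := N) (Torus.geometry d) t) volume volume :=
  measurePreserving_freeFlight_of_translate
    (measurable_fst.add (FunctionSpaces.Torus.measurable_proj.comp measurable_snd))
    (fun v => map_add_right_eq_self volume (FunctionSpaces.Torus.proj v)) t

/-- The image of a set under free flight is its preimage under the reversed free flight. [folklore] -/
theorem image_freeFlight_eq_preimage {X : Type*} (G : Geometry d X) (t : ℝ) (S : Set (Config N d X)) :
    freeFlight G t '' S = freeFlight G (-t) ⁻¹' S := by
  have h1 : LeftInverse (freeFlight (N := N) G (-t)) (freeFlight G t) := fun z => by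
    rw [← freeFlight_add, neg_add_cancel, freeFlight_zero]
  have h2 : RightInverse (freeFlight (N := N) G (-t)) (freeFlight G t) := fun z => by
    rw [← freeFlight_add, add_neg_cancel, freeFlight_zero]
  exact congrFun (image_eq_preimage_of_inverse h1 h2) S

/-- The image of a measurable set under free flight on the torus is measurable. [folklore] -/
theorem measurableSet_image_freeFlight (t : ℝ) {S : Set (Config N d (UnitAddTorus d))}
    (hS : MeasurableSet S) : MeasurableSet (freeFlight (Torus.geometry d) t '' S) := by
  rw [image_freeFlight_eq_preimage]
  exact (measurePreserving_freeFlight_torusGeometry (-t)).measurable hS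

/-- **Free flight preserves the volume of sets**: `vol(S_t '' S) = vol S`. [cite: CIP1994, §4.2] -/
theorem volume_image_freeFlight (t : ℝ) {S : Set (Config N d (UnitAddTorus d))}
    (hS : MeasurableSet S) : volume (freeFlight (Torus.geometry d) t '' S) = volume S := by
  rw [image_freeFlight_eq_preimage,
    ← Measure.map_apply (measurePreserving_freeFlight_torusGeometry (-t)).measurable hS,
    (measurePreserving_freeFlight_torusGeometry (-t)).map_eq]

/-! ## Shears along one coordinate preserve volume -/

section Shear

variable (i : Fin N)

/-- The shear of `(T^d × ℝ^d)^N` along coordinate `i` by the field `φ`: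
`z ↦ update z i (z i + φ z)`. When `φ` does not depend on coordinate `i` this is a
volume-preserving bijection (translations preserve Haar × Lebesgue measure, fibrewise). [folklore] -/
def shearAt (φ : Config N d (UnitAddTorus d) → UnitAddTorus d × EuclideanSpace ℝ d)
    (z : Config N d (UnitAddTorus d)) : Config N d (UnitAddTorus d) :=
  update z i (z i + φ z)

variable {i} {φ : Config N d (UnitAddTorus d) → UnitAddTorus d × EuclideanSpace ℝ d}

omit [Fintype d] in
/-- The sheared coordinate. [folklore] -/
@[simp]
theorem shearAt_apply_self (z : Config N d (UnitAddTorus d)) : shearAt i φ z i = z i + φ z := by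
  simp [shearAt]

omit [Fintype d] in
/-- The other coordinates are unchanged. [folklore] -/
theorem shearAt_apply_of_ne {k : Fin N} (hk : k ≠ i) (z : Config N d (UnitAddTorus d)) :
    shearAt i φ z k = z k := by
  simp [shearAt, update_of_ne hk]

/-- A shear is measurable when its field is. [folklore] -/
theorem measurable_shearAt (hφ : Measurable φ) : Measurable (shearAt i φ) :=
  measurable_update'.comp (measurable_id.prodMk ((measurable_pi_apply i).add hφ))

omit [Fintype d] in
/-- A field not depending on coordinate `i` is unchanged by the shear. [folklore] -/
theorem apply_shearAt (hφi : ∀ z a, φ (update z i a) = φ z) (z : Config N d (UnitAddTorus d)) :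
    φ (shearAt i φ z) = φ z :=
  hφi z _

omit [Fintype d] in
/-- The shear by `-φ` undoes the shear by `φ`. [folklore] -/
theorem shearAt_neg_shearAt (hφi : ∀ z a, φ (update z i a) = φ z) (z : Config N d (UnitAddTorus d)) :
    shearAt i (-φ) (shearAt i φ z) = z := by
  funext k
  by_cases hk : k = i
  · subst hk
    rw [shearAt_apply_self, shearAt_apply_self, Pi.neg_apply, apply_shearAt hφi,
      add_neg_cancel_right]
  · rw [shearAt_apply_of_ne hk, shearAt_apply_of_ne hk]

omit [Fintype d] in
/-- The shear by `φ` undoes the shear by `-φ`. [folklore] -/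
theorem shearAt_shearAt_neg (hφi : ∀ z a, φ (update z i a) = φ z) (z : Config N d (UnitAddTorus d)) :
    shearAt i φ (shearAt i (-φ) z) = z := by
  have h := shearAt_neg_shearAt (φ := -φ) (i := i) (fun z a => by simp [hφi z a]) z
  rwa [neg_neg] at h

/-- **Fubini along one coordinate: a shear does not change integrals.** [folklore] -/
theorem lintegral_comp_shearAt (hφ : Measurable φ) (hφi : ∀ z a, φ (update z i a) = φ z)
    {f : Config N d (UnitAddTorus d) → ℝ≥0∞} (hf : Measurable f) :
    ∫⁻ z, f (shearAt i φ z) = ∫⁻ z, f z := by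
  haveI := isAddRightInvariant_volume_phase (d := d)
  haveI : SigmaFinite (volume : Measure (UnitAddTorus d × EuclideanSpace ℝ d)) := inferInstance
  rw [volume_pi]
  refine lintegral_eq_of_lmarginal_eq {i} (hf.comp (measurable_shearAt hφ)) hf ?_
  rw [lmarginal_singleton, lmarginal_singleton]
  funext x
  show ∫⁻ a, f (shearAt i φ (update x i a)) ∂volume = ∫⁻ a, f (update x i a) ∂volume
  simp only [shearAt, update_idem, update_self, hφi]
  exact lintegral_add_right_eq_self (fun a => f (update x i a)) (φ x)

/-- **A shear along one coordinate preserves volume.** [folklore] -/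
theorem measurePreserving_shearAt (hφ : Measurable φ) (hφi : ∀ z a, φ (update z i a) = φ z) :
    MeasurePreserving (shearAt i φ) volume volume := by
  refine ⟨measurable_shearAt hφ, Measure.ext fun s hs => ?_⟩
  rw [Measure.map_apply (measurable_shearAt hφ) hs, ← lintegral_indicator_one hs,
    ← lintegral_indicator_one (measurable_shearAt hφ hs)]
  exact lintegral_comp_shearAt hφ hφi (measurable_one.indicator hs)

omit [Fintype d] in
/-- The image of a set under a shear is its preimage under the inverse shear. [folklore] -/
theorem image_shearAt (hφi : ∀ z a, φ (update z i a) = φ z) (S : Set (Config N d (UnitAddTorus d))) :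
    shearAt i φ '' S = shearAt i (-φ) ⁻¹' S :=
  congrFun (image_eq_preimage_of_inverse (shearAt_neg_shearAt hφi) (shearAt_shearAt_neg hφi)) S

/-- The image of a measurable set under a shear is measurable. [folklore] -/
theorem measurableSet_image_shearAt (hφ : Measurable φ) (hφi : ∀ z a, φ (update z i a) = φ z)
    {S : Set (Config N d (UnitAddTorus d))} (hS : MeasurableSet S) :
    MeasurableSet (shearAt i φ '' S) := by
  rw [image_shearAt hφi]
  exact measurable_shearAt hφ.neg hS

/-- **A shear along one coordinate preserves the volume of sets.** [folklore] -/
theorem volume_image_shearAt (hφ : Measurable φ) (hφi : ∀ z a, φ (update z i a) = φ z)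
    {S : Set (Config N d (UnitAddTorus d))} (hS : MeasurableSet S) :
    volume (shearAt i φ '' S) = volume S := by
  have hφi' : ∀ z a, (-φ) (update z i a) = (-φ) z := fun z a => by simp [hφi z a]
  rw [image_shearAt hφi, ← Measure.map_apply (measurable_shearAt hφ.neg) hS,
    (measurePreserving_shearAt hφ.neg hφi').map_eq]

end Shear

/-! ## A map acting on one coordinate only -/

section ApplyAt

variable (i : Fin N)

/-- Apply a self-map `b` of the one-particle phase space to coordinate `i` only. [folklore] -/
def applyAt (b : UnitAddTorus d × EuclideanSpace ℝ d → UnitAddTorus d × EuclideanSpace ℝ d)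
    (z : Config N d (UnitAddTorus d)) : Config N d (UnitAddTorus d) :=
  update z i (b (z i))

variable {i} {b : UnitAddTorus d × EuclideanSpace ℝ d → UnitAddTorus d × EuclideanSpace ℝ d}

omit [Fintype d] in
/-- The transformed coordinate. [folklore] -/
@[simp]
theorem applyAt_apply_self (z : Config N d (UnitAddTorus d)) : applyAt i b z i = b (z i) := by
  simp [applyAt]

omit [Fintype d] in
/-- The other coordinates are unchanged. [folklore] -/
theorem applyAt_apply_of_ne {k : Fin N} (hk : k ≠ i) (z : Config N d (UnitAddTorus d)) :
    applyAt i b z k = z k := by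
  simp [applyAt, update_of_ne hk]

omit [Fintype d] in
/-- `applyAt` is measurable when `b` is. [folklore] -/
theorem measurable_applyAt (hb : Measurable b) : Measurable (applyAt i b) :=
  measurable_update'.comp (measurable_id.prodMk (hb.comp (measurable_pi_apply i)))

omit [Fintype d] in
/-- `applyAt i b` is injective on a set whose `i`-th coordinates lie where `b` is injective. [folklore] -/
theorem injOn_applyAt {D₀ : Set (UnitAddTorus d × EuclideanSpace ℝ d)} (hinj : InjOn b D₀)
    {S : Set (Config N d (UnitAddTorus d))} (hsub : S ⊆ {z | z i ∈ D₀}) :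
    InjOn (applyAt i b) S := by
  intro z hz z' hz' heq
  funext k
  by_cases hk : k = i
  · subst hk
    have h := congrFun heq k
    rw [applyAt_apply_self, applyAt_apply_self] at h
    exact hinj (hsub hz) (hsub hz') h
  · have h := congrFun heq k
    rwa [applyAt_apply_of_ne hk, applyAt_apply_of_ne hk] at h

omit [Fintype d] in
/-- The sections of the image: `{a | update x i a ∈ applyAt i b '' S} = b '' {a | update x i a ∈ S}`. [folklore] -/
theorem section_image_applyAt (S : Set (Config N d (UnitAddTorus d))) (x : Config N d (UnitAddTorus d)) :
    {a | update x i a ∈ applyAt i b '' S} = b '' {a | update x i a ∈ S} := by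
  ext a
  simp only [mem_setOf_eq, mem_image]
  constructor
  · rintro ⟨z', hz', heq⟩
    refine ⟨z' i, ?_, ?_⟩
    · convert hz'
      funext k
      by_cases hk : k = i
      · subst hk; rw [update_self]
      · rw [update_of_ne hk]
        have h := congrFun heq k
        rw [applyAt_apply_of_ne hk, update_of_ne hk] at h
        exact h.symm
    · have h := congrFun heq i
      rwa [applyAt_apply_self, update_self] at h
  · rintro ⟨a', ha', rfl⟩
    refine ⟨update x i a', ha', ?_⟩
    funext k
    by_cases hk : k = i
    · subst hk; rw [applyAt_apply_self, update_self, update_self]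
    · rw [applyAt_apply_of_ne hk, update_of_ne hk, update_of_ne hk]

/-- **Image rule along one coordinate**: if `b` is measurable, injective on a measurable set
`D₀` and satisfies `vol(b '' Y) = vol Y` for measurable `Y ⊆ D₀`, then `applyAt i b`
satisfies `vol(applyAt i b '' S) = vol S` for measurable `S` with `i`-th coordinates in `D₀`
(Fubini over coordinate `i`; Lusin–Souslin for the measurability of the image). [folklore] -/
theorem volume_image_applyAt (hb : Measurable b) {D₀ : Set (UnitAddTorus d × EuclideanSpace ℝ d)}
    (hinj : InjOn b D₀)
    (hrule : ∀ Y ⊆ D₀, MeasurableSet Y → volume (b '' Y) = volume Y)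
    {S : Set (Config N d (UnitAddTorus d))} (hS : MeasurableSet S) (hsub : S ⊆ {z | z i ∈ D₀}) :
    MeasurableSet (applyAt i b '' S) ∧ volume (applyAt i b '' S) = volume S := by
  haveI := standardBorelSpace_config (d := d) (N := N)
  have hA : Measurable (applyAt i b) := measurable_applyAt hb
  have hmeas : MeasurableSet (applyAt i b '' S) :=
    hS.image_of_measurable_injOn hA (injOn_applyAt hinj hsub)
  refine ⟨hmeas, ?_⟩
  haveI : SigmaFinite (volume : Measure (UnitAddTorus d × EuclideanSpace ℝ d)) := inferInstance
  rw [← lintegral_indicator_one hmeas, ← lintegral_indicator_one hS, volume_pi]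
  refine lintegral_eq_of_lmarginal_eq {i} (measurable_one.indicator hmeas)
    (measurable_one.indicator hS) ?_
  rw [lmarginal_singleton, lmarginal_singleton]
  funext x
  have e1 : ∀ a, (applyAt i b '' S).indicator (1 : Config N d (UnitAddTorus d) → ℝ≥0∞)
      (update x i a) = {a | update x i a ∈ applyAt i b '' S}.indicator 1 a := by
    intro a; simp only [indicator, mem_setOf_eq]; rfl
  have e2 : ∀ a, S.indicator (1 : Config N d (UnitAddTorus d) → ℝ≥0∞) (update x i a) =
      {a | update x i a ∈ S}.indicator 1 a := by
    intro a; simp only [indicator, mem_setOf_eq]; rfl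
  have hm1 : MeasurableSet {a | update x i a ∈ applyAt i b '' S} := hmeas.preimage (measurable_update x)
  have hm2 : MeasurableSet {a | update x i a ∈ S} := hS.preimage (measurable_update x)
  simp_rw [e1, e2, lintegral_indicator_one hm1, lintegral_indicator_one hm2, section_image_applyAt]
  refine hrule _ (fun a ha => ?_) hm2
  have h := hsub ha
  simp only [mem_setOf_eq, update_self] at h
  exact h

end ApplyAt

/-! ## The one-particle billiard on `T^d × ℝ^d` -/

section Phase

/-- Lift a one-particle datum to the cube chart: `(x, v) ↦ (reprSym x, v)`. [folklore] -/
def liftPhase (a : UnitAddTorus d × EuclideanSpace ℝ d) : EuclideanSpace ℝ d × EuclideanSpace ℝ d :=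
  (Torus.reprSym a.1, a.2)

/-- Project a chart datum back to the torus: `(q, v) ↦ (proj q, v)`. [folklore] -/
def projPhase (u : EuclideanSpace ℝ d × EuclideanSpace ℝ d) : UnitAddTorus d × EuclideanSpace ℝ d :=
  (FunctionSpaces.Torus.proj u.1, u.2)

omit [Fintype d] in
/-- `projPhase ∘ liftPhase = id`. [folklore] -/
@[simp]
theorem projPhase_liftPhase (a : UnitAddTorus d × EuclideanSpace ℝ d) : projPhase (liftPhase a) = a := by
  simp [projPhase, liftPhase, Torus.proj_reprSym]

/-- On the cube `reprSym ∘ proj = id`. [folklore] -/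
theorem reprSym_proj_of_mem_symCube {q : EuclideanSpace ℝ d} (hq : q ∈ Torus.symCube d) :
    Torus.reprSym (FunctionSpaces.Torus.proj q) = q := by
  have h := Torus.reprSym_add_proj (x := (0 : UnitAddTorus d)) (s := q)
    (fun i => by rw [Torus.reprSym_zero]; simpa using hq i)
  rwa [zero_add, Torus.reprSym_zero, zero_add] at h

/-- `liftPhase ∘ projPhase = id` on the chart `symCube × ℝ^d`. [folklore] -/
theorem liftPhase_projPhase {u : EuclideanSpace ℝ d × EuclideanSpace ℝ d}
    (hu : u.1 ∈ Torus.symCube d) : liftPhase (projPhase u) = u := by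
  simp [projPhase, liftPhase, reprSym_proj_of_mem_symCube hu]

/-- `liftPhase` takes values in the chart. [folklore] -/
theorem liftPhase_fst_mem (a : UnitAddTorus d × EuclideanSpace ℝ d) : (liftPhase a).1 ∈ Torus.symCube d :=
  Torus.reprSym_mem_symCube a.1

omit [Fintype d] in
/-- `liftPhase` is injective. [folklore] -/
theorem liftPhase_injective : Injective (liftPhase : UnitAddTorus d × EuclideanSpace ℝ d → _) :=
  fun a a' h => by rw [← projPhase_liftPhase a, h, projPhase_liftPhase]

omit [Fintype d] in
/-- `liftPhase` is measurable. [folklore] -/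
theorem measurable_liftPhase : Measurable (liftPhase : UnitAddTorus d × EuclideanSpace ℝ d → _) :=
  (Torus.measurable_reprSym.comp measurable_fst).prodMk measurable_snd

/-- `projPhase` is measurable. [folklore] -/
theorem measurable_projPhase : Measurable (projPhase : EuclideanSpace ℝ d × EuclideanSpace ℝ d → _) :=
  (FunctionSpaces.Torus.measurable_proj.comp measurable_fst).prodMk measurable_snd

/-- **The chart pushes Haar × Lebesgue to Lebesgue on the cube**:
`liftPhase_* vol = vol|_{symCube × ℝ^d}`. [folklore] -/
theorem map_liftPhase_volume :
    Measure.map (liftPhase : UnitAddTorus d × EuclideanSpace ℝ d → _) volume =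
      volume.restrict (Torus.symCube d ×ˢ (univ : Set (EuclideanSpace ℝ d))) := by
  have h : (liftPhase : UnitAddTorus d × EuclideanSpace ℝ d → _) = Prod.map Torus.reprSym id := by
    funext a; rfl
  rw [h, Measure.volume_eq_prod, Measure.volume_eq_prod,
    ← Measure.map_prod_map _ _ Torus.measurable_reprSym measurable_id, Torus.map_reprSym_volume,
    Measure.map_id, ← Measure.restrict_univ (μ := (volume : Measure (EuclideanSpace ℝ d))),
    Measure.prod_restrict, Measure.restrict_univ]

/-- The image of a set under the chart: `liftPhase '' Y = projPhase ⁻¹' Y ∩ (symCube × ℝ^d)`. [folklore] -/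
theorem image_liftPhase (Y : Set (UnitAddTorus d × EuclideanSpace ℝ d)) :
    liftPhase '' Y = projPhase ⁻¹' Y ∩ Torus.symCube d ×ˢ (univ : Set (EuclideanSpace ℝ d)) := by
  ext u
  constructor
  · rintro ⟨a, ha, rfl⟩
    exact ⟨by simpa using ha, liftPhase_fst_mem a, mem_univ _⟩
  · rintro ⟨hu, hc, -⟩
    exact ⟨projPhase u, hu, liftPhase_projPhase hc⟩

/-- On the chart, the image under `projPhase` is the preimage under `liftPhase`. [folklore] -/
theorem image_projPhase {Z : Set (EuclideanSpace ℝ d × EuclideanSpace ℝ d)}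
    (hZ : Z ⊆ Torus.symCube d ×ˢ (univ : Set (EuclideanSpace ℝ d))) :
    projPhase '' Z = liftPhase ⁻¹' Z := by
  ext a
  constructor
  · rintro ⟨u, hu, rfl⟩
    show liftPhase (projPhase u) ∈ Z
    rwa [liftPhase_projPhase (hZ hu).1]
  · intro ha
    exact ⟨liftPhase a, ha, projPhase_liftPhase a⟩

/-- The chart image of a measurable set is measurable. [folklore] -/
theorem measurableSet_image_liftPhase {Y : Set (UnitAddTorus d × EuclideanSpace ℝ d)}
    (hY : MeasurableSet Y) : MeasurableSet (liftPhase '' Y) := by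
  rw [image_liftPhase]
  exact (measurable_projPhase hY).inter (Torus.measurableSet_symCube.prod MeasurableSet.univ)

/-- **The chart preserves the volume of sets**: `vol(liftPhase '' Y) = vol Y`. [folklore] -/
theorem volume_image_liftPhase {Y : Set (UnitAddTorus d × EuclideanSpace ℝ d)}
    (hY : MeasurableSet Y) : volume (liftPhase '' Y) = volume Y := by
  have hsub : liftPhase '' Y ⊆ Torus.symCube d ×ˢ (univ : Set (EuclideanSpace ℝ d)) := by
    rw [image_liftPhase]; exact inter_subset_right
  rw [← Measure.restrict_eq_self volume hsub, ← map_liftPhase_volume,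
    Measure.map_apply measurable_liftPhase (measurableSet_image_liftPhase hY),
    preimage_image_eq _ liftPhase_injective]

/-- **Projecting back preserves the volume of sets in the chart**: `vol(projPhase '' Z) = vol Z`
for measurable `Z ⊆ symCube × ℝ^d`. [folklore] -/
theorem volume_image_projPhase {Z : Set (EuclideanSpace ℝ d × EuclideanSpace ℝ d)}
    (hZ : MeasurableSet Z) (hsub : Z ⊆ Torus.symCube d ×ˢ (univ : Set (EuclideanSpace ℝ d))) :
    volume (projPhase '' Z) = volume Z := by
  rw [image_projPhase hsub, ← Measure.map_apply measurable_liftPhase hZ, map_liftPhase_volume,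
    Measure.restrict_eq_self volume hsub]

/-- The billiard map of the relative motion is measurable. [folklore] -/
theorem measurable_billiardMap (ε : ℝ) :
    Measurable (billiardMap ε : EuclideanSpace ℝ d × EuclideanSpace ℝ d → _) := by
  have hτ : Measurable fun u : EuclideanSpace ℝ d × EuclideanSpace ℝ d => pairHitTime ε u.1 u.2 := by
    unfold pairHitTime pairDisc
    fun_prop
  have hn : Measurable fun u : EuclideanSpace ℝ d × EuclideanSpace ℝ d => hitPoint ε u := by
    unfold hitPoint
    exact measurable_fst.add (hτ.smul measurable_snd)
  have hc : Measurable fun u : EuclideanSpace ℝ d × EuclideanSpace ℝ d =>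
      2 / ε ^ 2 * ⟪hitPoint ε u, u.2⟫_ℝ := (hn.inner measurable_snd).const_mul _
  have hv : Measurable fun u : EuclideanSpace ℝ d × EuclideanSpace ℝ d => hitVel ε u := by
    simp_rw [hitVel_eq]
    exact measurable_snd.sub (hc.smul hn)
  unfold billiardMap
  exact (hn.sub (hτ.smul hv)).prodMk hv

/-- **The one-particle billiard** of the pair data `(x, w) ∈ T^d × ℝ^d` (`x = x_i - x_j` on the
torus, `w = v_i - v_j`): lift to the chart, apply `billiardMap ε`, project back. [folklore] -/
def phaseBilliard (ε : ℝ) (a : UnitAddTorus d × EuclideanSpace ℝ d) :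
    UnitAddTorus d × EuclideanSpace ℝ d :=
  projPhase (billiardMap ε (liftPhase a))

/-- The one-particle billiard is measurable. [folklore] -/
theorem measurable_phaseBilliard (ε : ℝ) : Measurable (phaseBilliard (d := d) ε) :=
  measurable_projPhase.comp ((measurable_billiardMap ε).comp measurable_liftPhase)

/-- The good domain of the one-particle billiard with chart bound `ρ`: lifted data in
`billiardGood ε` whose billiard image has position of norm `≤ ρ`. [folklore] -/
def phaseGood (ε ρ : ℝ) : Set (UnitAddTorus d × EuclideanSpace ℝ d) :=
  {a | liftPhase a ∈ (billiardGood ε : Set (EuclideanSpace ℝ d × EuclideanSpace ℝ d)) ∧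
    ‖(billiardMap ε (liftPhase a)).1‖ ≤ ρ}

/-- The good domain is measurable. [folklore] -/
theorem measurableSet_phaseGood (ε ρ : ℝ) : MeasurableSet (phaseGood (d := d) ε ρ) := by
  have h1 : MeasurableSet {a : UnitAddTorus d × EuclideanSpace ℝ d |
      liftPhase a ∈ (billiardGood ε : Set (EuclideanSpace ℝ d × EuclideanSpace ℝ d))} :=
    measurable_liftPhase (isOpen_billiardGood ε).measurableSet
  have h2 : Measurable fun a : UnitAddTorus d × EuclideanSpace ℝ d =>
      billiardMap ε (liftPhase a) := (measurable_billiardMap ε).comp measurable_liftPhase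
  have h3 : Measurable fun a : UnitAddTorus d × EuclideanSpace ℝ d =>
      ‖(billiardMap ε (liftPhase a)).1‖ := (measurable_fst.comp h2).norm
  have h4 : MeasurableSet {a : UnitAddTorus d × EuclideanSpace ℝ d |
      ‖(billiardMap ε (liftPhase a)).1‖ ≤ ρ} := measurableSet_le h3 measurable_const
  exact h1.inter h4

/-- The one-particle billiard is injective on its good domain (`ρ < 1/2`). [folklore] -/
theorem injOn_phaseBilliard {ε ρ : ℝ} (hε : 0 < ε) (hρ : ρ < 1 / 2) :
    InjOn (phaseBilliard (d := d) ε) (phaseGood ε ρ) := by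
  intro a ha a' ha' heq
  have h1 : liftPhase (phaseBilliard ε a) = liftPhase (phaseBilliard ε a') := by rw [heq]
  rw [phaseBilliard, phaseBilliard,
    liftPhase_projPhase (Torus.closedBall_subset_symCube hρ (mem_closedBall_zero_iff.2 ha.2)),
    liftPhase_projPhase (Torus.closedBall_subset_symCube hρ (mem_closedBall_zero_iff.2 ha'.2))] at h1
  exact liftPhase_injective (billiardMap_injOn hε ha.1 ha'.1 h1)

/-- **The one-particle billiard preserves the volume of sets** in its good domain
(`addHaar_image_billiardMap` transported through the chart). [cite: CIP1994, §4.2 p. 65] -/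
theorem volume_image_phaseBilliard {ε ρ : ℝ} (hε : 0 < ε) (hρ : ρ < 1 / 2)
    {Y : Set (UnitAddTorus d × EuclideanSpace ℝ d)} (hY : MeasurableSet Y) (hsub : Y ⊆ phaseGood ε ρ) :
    volume (phaseBilliard ε '' Y) = volume Y := by
  haveI : (volume : Measure (EuclideanSpace ℝ d × EuclideanSpace ℝ d)).IsAddHaarMeasure := by
    rw [Measure.volume_eq_prod]; exact Measure.prod.instIsAddHaarMeasure _ _
  have himg : phaseBilliard ε '' Y = projPhase '' (billiardMap ε '' (liftPhase '' Y)) := by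
    rw [image_image, image_image]; rfl
  have h1 : MeasurableSet (liftPhase '' Y) := measurableSet_image_liftPhase hY
  have hgood : liftPhase '' Y ⊆ billiardGood ε := by
    rintro _ ⟨a, ha, rfl⟩; exact (hsub ha).1
  have h2 : billiardMap ε '' (liftPhase '' Y) ⊆
      Torus.symCube d ×ˢ (univ : Set (EuclideanSpace ℝ d)) := by
    rintro _ ⟨_, ⟨a, ha, rfl⟩, rfl⟩
    exact ⟨Torus.closedBall_subset_symCube hρ (mem_closedBall_zero_iff.2 (hsub ha).2), mem_univ _⟩
  rw [himg, volume_image_projPhase (measurableSet_image_billiardMap hε h1 hgood) h2,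
    addHaar_image_billiardMap volume hε h1 hgood, volume_image_liftPhase hY]

end Phase

/-! ## The two-body collision map of a pair preserves volume -/

section Pair

/-- The impulse of lifted pair data `u = (q, w)`: `(⟪n, w⟫ / ε²) n`, `n = hitPoint ε u`. [folklore] -/
def liftImpulse (ε : ℝ) (u : EuclideanSpace ℝ d × EuclideanSpace ℝ d) : EuclideanSpace ℝ d :=
  (⟪hitPoint ε u, u.2⟫_ℝ / ε ^ 2) • hitPoint ε u

/-- The position component of the billiard map: `q' = q + 2τ₀ b`. [folklore] -/
theorem billiardMap_fst (ε : ℝ) (u : EuclideanSpace ℝ d × EuclideanSpace ℝ d) :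
    (billiardMap ε u).1 = u.1 + (2 * pairHitTime ε u.1 u.2) • liftImpulse ε u := by
  simp only [billiardMap, liftImpulse]
  rw [hitVel_eq]
  simp only [hitPoint]
  module

/-- The velocity component of the billiard map: `w' = w - 2 b`. [folklore] -/
theorem billiardMap_snd (ε : ℝ) (u : EuclideanSpace ℝ d × EuclideanSpace ℝ d) :
    (billiardMap ε u).2 = u.2 - (2 : ℝ) • liftImpulse ε u := by
  simp only [billiardMap, liftImpulse]
  rw [hitVel_eq]
  module

/-- The impulse is a measurable function of the pair data. [folklore] -/
theorem measurable_liftImpulse (ε : ℝ) :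
    Measurable (liftImpulse ε : EuclideanSpace ℝ d × EuclideanSpace ℝ d → EuclideanSpace ℝ d) := by
  have hτ : Measurable fun u : EuclideanSpace ℝ d × EuclideanSpace ℝ d => pairHitTime ε u.1 u.2 := by
    unfold pairHitTime pairDisc
    fun_prop
  have hn : Measurable fun u : EuclideanSpace ℝ d × EuclideanSpace ℝ d => hitPoint ε u := by
    unfold hitPoint
    exact measurable_fst.add (hτ.smul measurable_snd)
  have hc : Measurable fun u : EuclideanSpace ℝ d × EuclideanSpace ℝ d =>
      ⟪hitPoint ε u, u.2⟫_ℝ / ε ^ 2 := (hn.inner measurable_snd).div_const _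
  exact hc.smul hn

/-- The translation of particle `j` caused by the collision, as a function of the relative
data `a = (x_i - x_j, v_i - v_j) ∈ T^d × ℝ^d` of the pair: `(-τ₀ b, b)`. [folklore] -/
def pairShiftField (ε : ℝ) (a : UnitAddTorus d × EuclideanSpace ℝ d) :
    UnitAddTorus d × EuclideanSpace ℝ d :=
  (-FunctionSpaces.Torus.proj (pairHitTime ε (liftPhase a).1 (liftPhase a).2 • liftImpulse ε (liftPhase a)),
    liftImpulse ε (liftPhase a))

/-- The translation field is measurable. [folklore] -/
theorem measurable_pairShiftField (ε : ℝ) : Measurable (pairShiftField (d := d) ε) := by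
  have hτ : Measurable fun u : EuclideanSpace ℝ d × EuclideanSpace ℝ d => pairHitTime ε u.1 u.2 := by
    unfold pairHitTime pairDisc
    fun_prop
  have h1 : Measurable fun a : UnitAddTorus d × EuclideanSpace ℝ d => liftImpulse ε (liftPhase a) :=
    (measurable_liftImpulse ε).comp measurable_liftPhase
  have h2 : Measurable fun a : UnitAddTorus d × EuclideanSpace ℝ d =>
      pairHitTime ε (liftPhase a).1 (liftPhase a).2 := hτ.comp measurable_liftPhase
  unfold pairShiftField
  exact (FunctionSpaces.Torus.measurable_proj.comp (h2.smul h1)).neg.prodMk h1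

variable {ε r δ V : ℝ} {i j : Fin N}

/-- **The two-body collision map in relative coordinates**: with `Ξ = shearAt i (z ↦ -z_j)`
(particle `i` relative to particle `j`), `Ξ ∘ pairCollide ε i j = applyAt i (phaseBilliard ε) ∘
shearAt j (pairShiftField ε ∘ (· i)) ∘ Ξ` — a one-coordinate billiard after a shear. [folklore] -/
theorem shearAt_pairCollide (hij : i ≠ j) (z : Config N d (UnitAddTorus d)) :
    shearAt i (fun z => -z j) (pairCollide ε i j z) =
      applyAt i (phaseBilliard ε)
        (shearAt j (fun z => pairShiftField ε (z i)) (shearAt i (fun z => -z j) z)) := by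
  have hlift : liftPhase (z i - z j) = ((Torus.geometry d).sepVec (z i).1 (z j).1, ((z i).2 - (z j).2)) := rfl
  have himp : liftImpulse ε ((Torus.geometry d).sepVec (z i).1 (z j).1, ((z i).2 - (z j).2)) = pairImpulse ε z i j := rfl
  have hψ : pairShiftField ε (z i - z j) =
      (-FunctionSpaces.Torus.proj (pairHitTime ε ((Torus.geometry d).sepVec (z i).1 (z j).1) ((z i).2 - (z j).2) • pairImpulse ε z i j), pairImpulse ε z i j) := by
    simp only [pairShiftField, hlift, himp]
  have hproj : FunctionSpaces.Torus.proj ((Torus.geometry d).sepVec (z i).1 (z j).1) = (z i).1 - (z j).1 := Torus.proj_reprSym _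
  have hB : phaseBilliard ε (z i - z j) =
      ((z i).1 - (z j).1 + FunctionSpaces.Torus.proj ((2 * pairHitTime ε ((Torus.geometry d).sepVec (z i).1 (z j).1) ((z i).2 - (z j).2)) • pairImpulse ε z i j),
        ((z i).2 - (z j).2) - (2 : ℝ) • pairImpulse ε z i j) := by
    simp only [phaseBilliard, projPhase, hlift, billiardMap_fst, billiardMap_snd, himp,
      FunctionSpaces.Torus.proj_add, hproj]
  have hΞi : shearAt i (fun z => -z j) z i = z i - z j := by
    rw [shearAt_apply_self, ← sub_eq_add_neg]
  -- coordinate `i`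
  have Hi : shearAt i (fun z => -z j) (pairCollide ε i j z) i =
      applyAt i (phaseBilliard ε)
        (shearAt j (fun z => pairShiftField ε (z i)) (shearAt i (fun z => -z j) z)) i := by
    rw [applyAt_apply_self, shearAt_apply_of_ne hij, hΞi, hB, shearAt_apply_self,
      pairCollide_apply_left hij, pairCollide_apply_right]
    refine Prod.ext ?_ ?_
    · simp only [Prod.fst_add, Prod.fst_neg]
      rw [mul_smul, two_smul, FunctionSpaces.Torus.proj_add]
      abel
    · simp only [Prod.snd_add, Prod.snd_neg]
      rw [two_smul]
      abel
  -- coordinate `j`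
  have Hj : shearAt i (fun z => -z j) (pairCollide ε i j z) j =
      applyAt i (phaseBilliard ε)
        (shearAt j (fun z => pairShiftField ε (z i)) (shearAt i (fun z => -z j) z)) j := by
    rw [applyAt_apply_of_ne hij.symm, shearAt_apply_self, shearAt_apply_of_ne hij.symm, hΞi, hψ,
      shearAt_apply_of_ne hij.symm, pairCollide_apply_right]
    refine Prod.ext ?_ ?_
    · simp only [Prod.fst_add]
      exact sub_eq_add_neg _ _
    · simp only [Prod.snd_add]
  -- the other coordinates
  have Hk : ∀ k, k ≠ i → k ≠ j → shearAt i (fun z => -z j) (pairCollide ε i j z) k =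
      applyAt i (phaseBilliard ε)
        (shearAt j (fun z => pairShiftField ε (z i)) (shearAt i (fun z => -z j) z)) k := by
    intro k hki hkj
    rw [applyAt_apply_of_ne hki, shearAt_apply_of_ne hkj, shearAt_apply_of_ne hki,
      shearAt_apply_of_ne hki, pairCollide_apply_of_ne hki hkj]
  funext k
  by_cases hki : k = i
  · rw [hki]; exact Hi
  by_cases hkj : k = j
  · rw [hkj]; exact Hj
  exact Hk k hki hkj

/-- On a hit piece of an energy shell the relative data of the pair lie in the good domain of
the one-particle billiard with chart bound `ε + r`: the billiard image has position
`n - τ₀ w'` of norm `≤ ε + 2Vδ ≤ ε + r`. [folklore] -/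
theorem sub_mem_phaseGood {z : Config N d (UnitAddTorus d)} (h : HitHyp ε r δ V z i j) :
    z i - z j ∈ phaseGood (d := d) ε (ε + r) := by
  have hlift : liftPhase (z i - z j) =
      ((Torus.geometry d).sepVec (z i).1 (z j).1, (z i).2 - (z j).2) := rfl
  refine ⟨by rw [hlift]; exact h.good, ?_⟩
  rw [hlift]
  simp only [billiardMap]
  have hw : ‖hitVel ε ((Torus.geometry d).sepVec (z i).1 (z j).1, (z i).2 - (z j).2)‖ ≤ 2 * V := by
    rw [norm_hitVel h.ε_pos h.good]
    exact norm_vel_sub_le h.norm_vel_le i j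
  calc ‖hitPoint ε ((Torus.geometry d).sepVec (z i).1 (z j).1, (z i).2 - (z j).2) -
        pairHitTime ε ((Torus.geometry d).sepVec (z i).1 (z j).1) ((z i).2 - (z j).2) •
          hitVel ε ((Torus.geometry d).sepVec (z i).1 (z j).1, (z i).2 - (z j).2)‖
      ≤ ‖hitPoint ε ((Torus.geometry d).sepVec (z i).1 (z j).1, (z i).2 - (z j).2)‖ +
          ‖pairHitTime ε ((Torus.geometry d).sepVec (z i).1 (z j).1) ((z i).2 - (z j).2) •
            hitVel ε ((Torus.geometry d).sepVec (z i).1 (z j).1, (z i).2 - (z j).2)‖ :=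
        norm_sub_le _ _
    _ ≤ ε + δ * (2 * V) := by
        rw [h.norm_hitPoint, norm_smul, Real.norm_eq_abs, abs_of_nonneg h.hitTime_pos.le]
        exact add_le_add_right (mul_le_mul h.hitTime_le hw (norm_nonneg _) h.δ_pos.le) ε
    _ ≤ ε + r := by linarith [h.window]

/-- **The two-body collision map of a pair preserves the volume of sets** in a hit piece of
an energy shell, and has measurable image there (Liouville's theorem for one binary
collision of `N` hard spheres on the torus; CIP 1994 §4.2 p. 65, App. 4.A). [cite: CIP1994, §4.2 p. 65] -/
theorem volume_image_pairCollide (hε : 0 < ε) (hεr : ε + 2 * r < 2⁻¹) (hr : 2 * V * δ ≤ r)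
    (hV0 : 0 ≤ V) (hij : i < j) {A : Set (Config N d (UnitAddTorus d))} (hA : MeasurableSet A)
    (hsub : A ⊆ hitPiece N ε r δ i j ∩ {z | configEnergy z ≤ V ^ 2 / 2}) :
    MeasurableSet (pairCollide ε i j '' A) ∧ volume (pairCollide ε i j '' A) = volume A := by
  have hne : i ≠ j := ne_of_lt hij
  rcases eq_empty_or_nonempty A with rfl | ⟨z₀, hz₀⟩
  · simp
  have hr0 : 0 ≤ r := (HitHyp.mk hε hεr hr hV0 (hsub hz₀).2 hij (hsub hz₀).1).r_nonneg
  -- the four maps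
  set φ : Config N d (UnitAddTorus d) → UnitAddTorus d × EuclideanSpace ℝ d := fun z => -z j
    with hφdef
  set ψ : Config N d (UnitAddTorus d) → UnitAddTorus d × EuclideanSpace ℝ d :=
    fun z => pairShiftField ε (z i) with hψdef
  have hφ : Measurable φ := (measurable_pi_apply j).neg
  have hφi : ∀ z a, φ (update z i a) = φ z := fun z a => by
    simp only [hφdef, update_of_ne hne.symm]
  have hφi' : ∀ z a, (-φ) (update z i a) = (-φ) z := fun z a => by simp [hφi z a]
  have hψ : Measurable ψ := (measurable_pairShiftField ε).comp (measurable_pi_apply i)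
  have hψj : ∀ z a, ψ (update z j a) = ψ z := fun z a => by
    simp only [hψdef, update_of_ne hne]
  -- the factorisation
  have hfac : ∀ z, pairCollide ε i j z =
      shearAt i (-φ) (applyAt i (phaseBilliard ε) (shearAt j ψ (shearAt i φ z))) := by
    intro z
    rw [← shearAt_pairCollide hne z, shearAt_neg_shearAt hφi]
  have himg : pairCollide ε i j '' A =
      shearAt i (-φ) '' (applyAt i (phaseBilliard ε) '' (shearAt j ψ '' (shearAt i φ '' A))) := by
    simp only [image_image]
    exact image_congr fun z _ => hfac z
  -- the first two shears
  have h1m : MeasurableSet (shearAt i φ '' A) := measurableSet_image_shearAt hφ hφi hA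
  have h1v : volume (shearAt i φ '' A) = volume A := volume_image_shearAt hφ hφi hA
  have h2m : MeasurableSet (shearAt j ψ '' (shearAt i φ '' A)) := measurableSet_image_shearAt hψ hψj h1m
  have h2v : volume (shearAt j ψ '' (shearAt i φ '' A)) = volume (shearAt i φ '' A) :=
    volume_image_shearAt hψ hψj h1m
  -- the one-coordinate billiard
  have hρ : ε + r < 1 / 2 := by
    have : (2⁻¹ : ℝ) = 1 / 2 := by norm_num
    linarith
  have hsub3 : shearAt j ψ '' (shearAt i φ '' A) ⊆ {y | y i ∈ phaseGood ε (ε + r)} := by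
    rintro _ ⟨_, ⟨z, hz, rfl⟩, rfl⟩
    simp only [mem_setOf_eq]
    rw [shearAt_apply_of_ne hne, shearAt_apply_self, hφdef, ← sub_eq_add_neg]
    exact sub_mem_phaseGood (HitHyp.mk hε hεr hr hV0 (hsub hz).2 hij (hsub hz).1)
  obtain ⟨h3m, h3v⟩ := volume_image_applyAt (i := i) (measurable_phaseBilliard ε)
    (injOn_phaseBilliard hε hρ)
    (fun Y hY hYm => volume_image_phaseBilliard hε hρ hYm hY) h2m hsub3
  -- the last shear
  have h4m : MeasurableSet (shearAt i (-φ) '' (applyAt i (phaseBilliard ε) ''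
      (shearAt j ψ '' (shearAt i φ '' A)))) := measurableSet_image_shearAt hφ.neg hφi' h3m
  have h4v := volume_image_shearAt hφ.neg hφi' h3m
  rw [himg]
  exact ⟨h4m, by rw [h4v, h3v, h2v, h1v]⟩

end Pair

/-! ## Measurability of the pieces of the short-time good set -/

section Measurability

variable {ε r δ V : ℝ}

/-- The relative data `(x_i - x_j, v_i - v_j)` (minimal image) depend measurably on the datum. [folklore] -/
theorem measurable_relData (i j : Fin N) :
    Measurable fun z : Config N d (UnitAddTorus d) =>
      (((Torus.geometry d).sepVec (z i).1 (z j).1, (z i).2 - (z j).2) :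
        EuclideanSpace ℝ d × EuclideanSpace ℝ d) :=
  (Torus.isMeasurable_geometry.measurable_sepVec_config i j).prodMk
    ((Geometry.IsMeasurable.measurable_vel i).sub (Geometry.IsMeasurable.measurable_vel j))

/-- The minimal-image distance of a pair is a measurable function of the datum. [folklore] -/
theorem measurable_norm_sepVec (i j : Fin N) :
    Measurable fun z : Config N d (UnitAddTorus d) => ‖(Torus.geometry d).sepVec (z i).1 (z j).1‖ :=
  (Torus.isMeasurable_geometry.measurable_sepVec_config i j).norm

/-- The far set is measurable. [folklore] -/
theorem measurableSet_farSet (ε r : ℝ) : MeasurableSet (farSet (d := d) N ε r) := by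
  have : farSet (d := d) N ε r = ⋂ k : Fin N, ⋂ l : Fin N,
      {z | k ≠ l → z ∈ {z | ε + r < ‖(Torus.geometry d).sepVec (z k).1 (z l).1‖}} := by
    ext z; simp only [farSet, mem_setOf_eq, mem_iInter]
  rw [this]
  exact MeasurableSet.iInter fun k => MeasurableSet.iInter fun l =>
    (MeasurableSet.const _).imp (measurableSet_lt measurable_const (measurable_norm_sepVec k l))

/-- `OthersFar` cuts out a measurable set. [folklore] -/
theorem measurableSet_othersFar (ε r : ℝ) (i j : Fin N) :
    MeasurableSet {z : Config N d (UnitAddTorus d) | OthersFar ε r z i j} := by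
  have : {z : Config N d (UnitAddTorus d) | OthersFar ε r z i j} = ⋂ k : Fin N, ⋂ l : Fin N,
      {z | k ≠ l → z ∈ {z | ({k, l} : Finset (Fin N)) ≠ {i, j} →
        z ∈ {z | ε + r < ‖(Torus.geometry d).sepVec (z k).1 (z l).1‖}}} := by
    ext z; simp only [OthersFar, mem_setOf_eq, mem_iInter]
  rw [this]
  exact MeasurableSet.iInter fun k => MeasurableSet.iInter fun l =>
    (MeasurableSet.const _).imp ((MeasurableSet.const _).imp
      (measurableSet_lt measurable_const (measurable_norm_sepVec k l)))

/-- The hitting time of a pair is a measurable function of the datum. [folklore] -/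
theorem measurable_pairHitTime_config (ε : ℝ) (i j : Fin N) :
    Measurable fun z : Config N d (UnitAddTorus d) =>
      pairHitTime ε ((Torus.geometry d).sepVec (z i).1 (z j).1) ((z i).2 - (z j).2) := by
  have hτ : Measurable fun u : EuclideanSpace ℝ d × EuclideanSpace ℝ d => pairHitTime ε u.1 u.2 := by
    unfold pairHitTime pairDisc
    fun_prop
  have h := hτ.comp (measurable_relData i j)
  simpa only [Function.comp_def] using h

/-- `PairHits` cuts out a measurable set of data. [folklore] -/
theorem measurableSet_pairHits_config (ε : ℝ) (i j : Fin N) :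
    MeasurableSet {z : Config N d (UnitAddTorus d) |
      PairHits ε ((Torus.geometry d).sepVec (z i).1 (z j).1) ((z i).2 - (z j).2)} := by
  have h1 : Measurable fun u : EuclideanSpace ℝ d × EuclideanSpace ℝ d => ⟪u.1, u.2⟫_ℝ := by
    fun_prop
  have h2 : Measurable fun u : EuclideanSpace ℝ d × EuclideanSpace ℝ d => pairDisc ε u.1 u.2 := by
    unfold pairDisc
    fun_prop
  have hs : MeasurableSet {u : EuclideanSpace ℝ d × EuclideanSpace ℝ d | PairHits ε u.1 u.2} :=
    (measurableSet_lt h1 measurable_const).inter (measurableSet_le measurable_const h2)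
  exact measurable_relData i j hs

/-- The no-hit pieces are measurable. [folklore] -/
theorem measurableSet_noHitPiece (ε r δ : ℝ) (i j : Fin N) :
    MeasurableSet (noHitPiece (d := d) N ε r δ i j) := by
  have h : noHitPiece (d := d) N ε r δ i j = {z | OthersFar ε r z i j} ∩
      ({z | ε < ‖(Torus.geometry d).sepVec (z i).1 (z j).1‖} ∩
        ({z | ‖(Torus.geometry d).sepVec (z i).1 (z j).1‖ ≤ ε + r} ∩
          ({z : Config N d (UnitAddTorus d) |
              PairHits ε ((Torus.geometry d).sepVec (z i).1 (z j).1) ((z i).2 - (z j).2)}ᶜ ∪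
            {z | δ < pairHitTime ε ((Torus.geometry d).sepVec (z i).1 (z j).1)
              ((z i).2 - (z j).2)}))) := by
    ext z
    simp only [noHitPiece, mem_setOf_eq, mem_inter_iff, mem_union, mem_compl_iff]
  rw [h]
  exact (measurableSet_othersFar ε r i j).inter
    ((measurableSet_lt measurable_const (measurable_norm_sepVec i j)).inter
      ((measurableSet_le (measurable_norm_sepVec i j) measurable_const).inter
        ((measurableSet_pairHits_config ε i j).compl.union
          (measurableSet_lt measurable_const (measurable_pairHitTime_config ε i j)))))

/-- The hit pieces are measurable. [folklore] -/
theorem measurableSet_hitPiece (ε r δ : ℝ) (i j : Fin N) :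
    MeasurableSet (hitPiece (d := d) N ε r δ i j) := by
  have h : hitPiece (d := d) N ε r δ i j = {z | OthersFar ε r z i j} ∩
      ({z | ‖(Torus.geometry d).sepVec (z i).1 (z j).1‖ ≤ ε + r} ∩
        ((fun z : Config N d (UnitAddTorus d) =>
            (((Torus.geometry d).sepVec (z i).1 (z j).1, (z i).2 - (z j).2) :
              EuclideanSpace ℝ d × EuclideanSpace ℝ d)) ⁻¹' billiardGood ε ∩
          {z | pairHitTime ε ((Torus.geometry d).sepVec (z i).1 (z j).1) ((z i).2 - (z j).2) ≤ δ})) := by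
    ext z
    simp only [hitPiece, mem_setOf_eq, mem_inter_iff, mem_preimage]
  have hgood : MeasurableSet (billiardGood ε : Set (EuclideanSpace ℝ d × EuclideanSpace ℝ d)) :=
    (isOpen_billiardGood ε).measurableSet
  have h3 : MeasurableSet ((fun z : Config N d (UnitAddTorus d) =>
      (((Torus.geometry d).sepVec (z i).1 (z j).1, (z i).2 - (z j).2) :
        EuclideanSpace ℝ d × EuclideanSpace ℝ d)) ⁻¹' billiardGood ε) :=
    measurableSet_preimage (measurable_relData i j) hgood
  have h4 : MeasurableSet {z : Config N d (UnitAddTorus d) |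
      pairHitTime ε ((Torus.geometry d).sepVec (z i).1 (z j).1) ((z i).2 - (z j).2) ≤ δ} :=
    measurableSet_le (measurable_pairHitTime_config ε i j) measurable_const
  rw [h]
  exact (measurableSet_othersFar ε r i j).inter
    ((measurableSet_le (measurable_norm_sepVec i j) measurable_const).inter (h3.inter h4))

/-- The short-time good set is measurable. [folklore] -/
theorem measurableSet_shortGood (ε r δ : ℝ) : MeasurableSet (shortGood (d := d) N ε r δ) := by
  refine (measurableSet_farSet ε r).union (MeasurableSet.iUnion fun p => MeasurableSet.iUnion fun _ =>
    (measurableSet_noHitPiece ε r δ p.1 p.2).union (measurableSet_hitPiece ε r δ p.1 p.2))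

/-- The kinetic energy is a measurable function of the datum (continuity, for the torus, is
`continuous_configEnergy` in `MathematicalPhysics/KineticTheory/HardBallErgodicity.lean`; only
measurability is needed here, and importing that file would add a cross-topic dependency).
[folklore] -/
theorem measurable_configEnergy : Measurable (configEnergy : Config N d (UnitAddTorus d) → ℝ) := by
  unfold configEnergy
  exact measurable_const.mul
    (Finset.measurable_sum _ fun i _ => (Geometry.IsMeasurable.measurable_vel i).norm.pow_const 2)

/-- Energy shells are measurable. [folklore] -/
theorem measurableSet_energyShell (c : ℝ) :
    MeasurableSet {z : Config N d (UnitAddTorus d) | configEnergy z ≤ c} :=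
  measurableSet_le measurable_configEnergy measurable_const

end Measurability

/-! ## The flow over the window does not lose volume -/

section Step

variable {ε r δ V : ℝ}

variable (N) in
/-- The pieces of the short-time good set indexed by a finite type: `none ↦ farSet`,
`some (p, false) ↦ noHitPiece p`, `some (p, true) ↦ hitPiece p` (for ordered pairs `p.1 < p.2`,
else `∅`). [folklore] -/
def shortPiece (ε r δ : ℝ) : Option ((Fin N × Fin N) × Bool) → Set (Config N d (UnitAddTorus d))
  | none => farSet N ε r
  | some (p, false) => if p.1 < p.2 then noHitPiece N ε r δ p.1 p.2 else ∅
  | some (p, true) => if p.1 < p.2 then hitPiece N ε r δ p.1 p.2 else ∅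

/-- The short-time good set is the union of its pieces. [folklore] -/
theorem shortGood_subset_iUnion_shortPiece :
    shortGood (d := d) N ε r δ ⊆ ⋃ ι, shortPiece N ε r δ ι := by
  intro z hz
  rcases mem_shortGood.1 hz with h | ⟨p, hp, h | h⟩
  · exact mem_iUnion.2 ⟨none, h⟩
  · exact mem_iUnion.2 ⟨some (p, false), by simp only [shortPiece, if_pos hp]; exact h⟩
  · exact mem_iUnion.2 ⟨some (p, true), by simp only [shortPiece, if_pos hp]; exact h⟩

/-- The pieces are measurable. [folklore] -/
theorem measurableSet_shortPiece (ι : Option ((Fin N × Fin N) × Bool)) :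
    MeasurableSet (shortPiece (d := d) N ε r δ ι) := by
  rcases ι with _ | ⟨p, _ | _⟩
  · exact measurableSet_farSet ε r
  · simp only [shortPiece]
    split_ifs
    · exact measurableSet_noHitPiece ε r δ p.1 p.2
    · exact MeasurableSet.empty
  · simp only [shortPiece]
    split_ifs
    · exact measurableSet_hitPiece ε r δ p.1 p.2
    · exact MeasurableSet.empty

/-- The pieces are pairwise disjoint. [folklore] -/
theorem eq_of_mem_shortPiece {z : Config N d (UnitAddTorus d)} {ι ι' : Option ((Fin N × Fin N) × Bool)}
    (hz : z ∈ shortPiece N ε r δ ι) (hz' : z ∈ shortPiece N ε r δ ι') : ι = ι' := by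
  -- unpack an index into far / no-hit / hit data
  have unpack : ∀ {κ : Option ((Fin N × Fin N) × Bool)}, z ∈ shortPiece N ε r δ κ →
      κ = none ∧ z ∈ farSet N ε r ∨
      ∃ p : Fin N × Fin N, p.1 < p.2 ∧
        (κ = some (p, false) ∧ z ∈ noHitPiece N ε r δ p.1 p.2 ∨
          κ = some (p, true) ∧ z ∈ hitPiece N ε r δ p.1 p.2) := by
    intro κ hκ
    rcases κ with _ | ⟨p, _ | _⟩
    · exact Or.inl ⟨rfl, hκ⟩
    · simp only [shortPiece] at hκ
      split_ifs at hκ with hp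
      · exact Or.inr ⟨p, hp, Or.inl ⟨rfl, hκ⟩⟩
      · exact absurd hκ (notMem_empty z)
    · simp only [shortPiece] at hκ
      split_ifs at hκ with hp
      · exact Or.inr ⟨p, hp, Or.inr ⟨rfl, hκ⟩⟩
      · exact absurd hκ (notMem_empty z)
  -- far excludes any close pair
  have far_noHit : ∀ {p : Fin N × Fin N}, p.1 < p.2 → z ∈ farSet N ε r →
      z ∉ noHitPiece N ε r δ p.1 p.2 := by
    intro p hp hf hn
    exact (not_le.2 (hf p.1 p.2 hp.ne)) hn.2.2.1
  -- two no-hit pieces with different pairs are disjoint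
  have noHit_noHit : ∀ {p p' : Fin N × Fin N}, p.1 < p.2 → p'.1 < p'.2 →
      z ∈ noHitPiece N ε r δ p.1 p.2 → z ∈ noHitPiece N ε r δ p'.1 p'.2 → p = p' := by
    intro p p' hp hp' hn hn'
    by_cases hpp : ({p'.1, p'.2} : Finset (Fin N)) = {p.1, p.2}
    · obtain ⟨h1, h2⟩ := eq_of_pair_eq_of_lt hp hp' hpp
      exact (Prod.ext h1 h2).symm
    · exact absurd hn'.2.2.1 (not_le.2 (hn.1 p'.1 p'.2 hp'.ne hpp))
  rcases unpack hz with ⟨rfl, hf⟩ | ⟨p, hp, ⟨rfl, hn⟩ | ⟨rfl, hh⟩⟩ <;>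
    rcases unpack hz' with ⟨rfl, hf'⟩ | ⟨p', hp', ⟨rfl, hn'⟩ | ⟨rfl, hh'⟩⟩
  · rfl
  · exact absurd hn' (far_noHit hp' hf)
  · exact absurd hh' (not_mem_hitPiece_of_mem_farSet hf hp'.ne)
  · exact absurd hn (far_noHit hp hf')
  · rw [noHit_noHit hp hp' hn hn']
  · exact absurd hh' (not_mem_hitPiece_of_mem_noHitPiece hp hn hp')
  · exact absurd hh (not_mem_hitPiece_of_mem_farSet hf' hp.ne)
  · exact absurd hh (not_mem_hitPiece_of_mem_noHitPiece hp' hn' hp)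
  · obtain ⟨h1, h2⟩ := eq_of_mem_hitPiece_of_mem_hitPiece hp hp' hh hh'
    rw [show p' = p from Prod.ext h1 h2]

/-- Free flight on the torus is injective. [folklore] -/
theorem freeFlight_injective (t : ℝ) : Injective (freeFlight (N := N) (Torus.geometry d) t) := by
  intro z z' h
  have := congrArg (freeFlight (Torus.geometry d) (-t)) h
  rwa [← freeFlight_add, ← freeFlight_add, neg_add_cancel, freeFlight_zero, freeFlight_zero] at this

/-- **The flow at time `δ` is injective on the short-time good part of an energy shell**
(`Φ_δ = S_δ ∘ kick` there, and both factors are injective). [folklore] -/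
theorem injOn_fwdFlow_shortGood (hε : 0 < ε) (hεr : ε + 2 * r < 2⁻¹) (hr : 2 * V * δ ≤ r)
    (hV0 : 0 ≤ V) (hδ : 0 ≤ δ) :
    InjOn (fun z : Config N d (UnitAddTorus d) => fwdFlow (Torus.geometry d) ε z δ)
      (shortGood N ε r δ ∩ {z | configEnergy z ≤ V ^ 2 / 2}) := by
  rintro z ⟨hz, hE⟩ z' ⟨hz', hE'⟩ heq
  simp only at heq
  rw [fwdFlow_eq_freeFlight_kick hε hεr hr hV0 hδ hE hz,
    fwdFlow_eq_freeFlight_kick hε hεr hr hV0 hδ hE' hz'] at heq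
  exact kick_injOn hε hεr hr hV0 ⟨hz, hE⟩ ⟨hz', hE'⟩ (freeFlight_injective δ heq)

/-- On each piece, the image under the flow at time `δ` of a measurable subset of an energy
shell is measurable and has the same volume (free flight, or free flight after the two-body
collision map). [folklore] -/
theorem volume_image_fwdFlow_shortPiece (hε : 0 < ε) (hεr : ε + 2 * r < 2⁻¹) (hr : 2 * V * δ ≤ r)
    (hV0 : 0 ≤ V) (hδ : 0 ≤ δ) (ι : Option ((Fin N × Fin N) × Bool))
    {X : Set (Config N d (UnitAddTorus d))} (hX : MeasurableSet X)
    (hsub : X ⊆ shortPiece N ε r δ ι ∩ {z | configEnergy z ≤ V ^ 2 / 2}) :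
    MeasurableSet ((fun z => fwdFlow (Torus.geometry d) ε z δ) '' X) ∧
      volume ((fun z => fwdFlow (Torus.geometry d) ε z δ) '' X) = volume X := by
  have hr0 : 0 ≤ r := le_trans (by positivity) hr
  have hε' : ε < 2⁻¹ := by linarith
  -- the no-collision case: the flow is free flight on `X`
  have free_case : (∀ z ∈ X, ∀ t ∈ Icc (0 : ℝ) δ, ∀ k l : Fin N, k ≠ l →
      ε < ‖(Torus.geometry d).sepVec (freeFlight (Torus.geometry d) t z k).1
        (freeFlight (Torus.geometry d) t z l).1‖) →
      MeasurableSet ((fun z => fwdFlow (Torus.geometry d) ε z δ) '' X) ∧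
        volume ((fun z => fwdFlow (Torus.geometry d) ε z δ) '' X) = volume X := by
    intro H
    have himg : (fun z => fwdFlow (Torus.geometry d) ε z δ) '' X =
        freeFlight (Torus.geometry d) δ '' X :=
      image_congr fun z hz => fwdFlow_eq_freeFlight_of_forall_lt_norm hε' hδ (H z hz) ⟨hδ, le_rfl⟩
    rw [himg]
    exact ⟨measurableSet_image_freeFlight δ hX, volume_image_freeFlight δ hX⟩
  rcases ι with _ | ⟨p, _ | _⟩
  · refine free_case fun z hz => ?_
    exact forall_lt_norm_of_mem_farSet (norm_vel_le_of_configEnergy_le hV0 (hsub hz).2) hr (hsub hz).1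
  · by_cases hp : p.1 < p.2
    · refine free_case fun z hz => ?_
      have h1 : z ∈ noHitPiece N ε r δ p.1 p.2 := by
        have := (hsub hz).1; simp only [shortPiece, if_pos hp] at this; exact this
      exact forall_lt_norm_of_mem_noHitPiece hε (norm_vel_le_of_configEnergy_le hV0 (hsub hz).2)
        hr hεr h1
    · have hXe : X = ∅ := by
        refine eq_empty_of_forall_notMem fun z hz => ?_
        have := (hsub hz).1; simp only [shortPiece, if_neg hp] at this; exact this
      subst hXe
      simp
  · by_cases hp : p.1 < p.2
    · have hsub' : X ⊆ hitPiece N ε r δ p.1 p.2 ∩ {z | configEnergy z ≤ V ^ 2 / 2} := by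
        intro z hz
        have := (hsub hz).1; simp only [shortPiece, if_pos hp] at this
        exact ⟨this, (hsub hz).2⟩
      have himg : (fun z => fwdFlow (Torus.geometry d) ε z δ) '' X =
          freeFlight (Torus.geometry d) δ '' (pairCollide ε p.1 p.2 '' X) := by
        rw [image_image]
        exact image_congr fun z hz =>
          (HitHyp.mk hε hεr hr hV0 (hsub' hz).2 hp (hsub' hz).1).fwdFlow_eq_freeFlight_pairCollide
      obtain ⟨hm, hv⟩ := volume_image_pairCollide hε hεr hr hV0 hp hX hsub'
      rw [himg]
      exact ⟨measurableSet_image_freeFlight δ hm, by rw [volume_image_freeFlight δ hm, hv]⟩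
    · have hXe : X = ∅ := by
        refine eq_empty_of_forall_notMem fun z hz => ?_
        have := (hsub hz).1; simp only [shortPiece, if_neg hp] at this; exact this
      subst hXe
      simp

/-- **The hard-sphere flow over a short window does not lose volume** (GST 2013, proof of
Prop. 4.1.1: "since the measure is invariant by the flow"; CIP 1994 App. 4.A): for every
measurable `B`, the short-time good data of the energy shell `E ≤ V²/2` that the flow at time
`δ` carries into `B` have volume at most `vol B` (`0 < ε`, `ε + 2r < 1/2`, `2Vδ ≤ r`,
`0 ≤ δ`, `0 ≤ V`). [cite: GST2013, proof of Prop. 4.1.1 p. 19] -/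
theorem volume_shortGood_inter_preimage_fwdFlow_le (hε : 0 < ε) (hεr : ε + 2 * r < 2⁻¹)
    (hr : 2 * V * δ ≤ r) (hV0 : 0 ≤ V) (hδ : 0 ≤ δ) {B : Set (Config N d (UnitAddTorus d))}
    (hB : MeasurableSet B) :
    volume {z : Config N d (UnitAddTorus d) | z ∈ shortGood N ε r δ ∧ configEnergy z ≤ V ^ 2 / 2 ∧
      fwdFlow (Torus.geometry d) ε z δ ∈ B} ≤ volume B := by
  have hr0 : 0 ≤ r := le_trans (by positivity) hr
  have hε' : ε < 2⁻¹ := by linarith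
  have hG := Torus.isHardSphereRegular_geometry (d := d) hε'
  set T : Config N d (UnitAddTorus d) → Config N d (UnitAddTorus d) :=
    fun z => fwdFlow (Torus.geometry d) ε z δ with hT
  have hTm : Measurable T := measurable_fwdFlow hG Torus.isMeasurable_geometry δ
  set A : Set (Config N d (UnitAddTorus d)) := {z | z ∈ shortGood N ε r δ ∧
    configEnergy z ≤ V ^ 2 / 2 ∧ fwdFlow (Torus.geometry d) ε z δ ∈ B} with hA
  have hAm : MeasurableSet A :=
    (measurableSet_shortGood ε r δ).inter ((measurableSet_energyShell _).inter (hTm hB))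
  -- decomposition along the pieces
  have key : ∀ ι, MeasurableSet (T '' (A ∩ shortPiece N ε r δ ι)) ∧
      volume (T '' (A ∩ shortPiece N ε r δ ι)) = volume (A ∩ shortPiece N ε r δ ι) :=
    fun ι => volume_image_fwdFlow_shortPiece hε hεr hr hV0 hδ ι (hAm.inter (measurableSet_shortPiece ι))
      fun z hz => ⟨hz.2, hz.1.2.1⟩
  have hdisj : Pairwise (Disjoint on fun ι => T '' (A ∩ shortPiece N ε r δ ι)) := by
    intro ι ι' hne
    rw [Function.onFun, disjoint_left]
    rintro _ ⟨z, ⟨hzA, hzP⟩, rfl⟩ ⟨z', ⟨hz'A, hz'P⟩, heq⟩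
    have hzz : z' = z := injOn_fwdFlow_shortGood hε hεr hr hV0 hδ ⟨hz'A.1, hz'A.2.1⟩ ⟨hzA.1, hzA.2.1⟩ heq
    subst hzz
    exact hne (eq_of_mem_shortPiece hzP hz'P)
  calc volume A ≤ volume (⋃ ι, A ∩ shortPiece N ε r δ ι) := by
        refine measure_mono fun z hz => ?_
        obtain ⟨ι, hι⟩ := mem_iUnion.1 (shortGood_subset_iUnion_shortPiece hz.1)
        exact mem_iUnion.2 ⟨ι, hz, hι⟩
    _ ≤ ∑ ι, volume (A ∩ shortPiece N ε r δ ι) := measure_iUnion_fintype_le _ _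
    _ = ∑ ι, volume (T '' (A ∩ shortPiece N ε r δ ι)) :=
        Finset.sum_congr rfl fun ι _ => (key ι).2.symm
    _ = volume (⋃ ι, T '' (A ∩ shortPiece N ε r δ ι)) := by
        rw [measure_iUnion hdisj fun ι => (key ι).1, tsum_fintype]
    _ ≤ volume B := by
        refine measure_mono (iUnion_subset fun ι => ?_)
        rintro _ ⟨z, ⟨hzA, -⟩, rfl⟩
        exact hzA.2.2

end Step

end Alexander

end Kinetic

end

end Literature.Analysis.FluidPDE
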